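import Literature.Computability.Learning.PAC
import Mathlib.Analysis.SpecialFunctions.Log.Basic
import HarnessLib

/-!
# Occam's razor, cardinality version: consistent hypotheses from a finite class generalise

Named facts (D-0014) requested by route PneNP/Learning (`wi-03893`): the learning bound for a
FINITE hypothesis set in the consistent case (Blumer–Ehrenfeucht–Haussler–Warmuth 1987 "Occam's
razor"; Kearns–Vazirani 1994, Thm. 2.1 (cardinality version); here vendored from
Mohri–Rostamizadeh–Talwalkar, *Foundations of Machine Learning* (2nd ed. 2018), Thm. 2.5 and its
proof, whose text was checked).

For a distribution `D` on `X`, a target `c : X → Y`, a finite set `H` of hypotheses and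
`m` i.i.d. sample points `S ∼ D^m` (`Literature.Learning.iidList D m`):

* `occam_uniform_bound` — the uniform-convergence inequality established in the proof of
  Thm. 2.5: `Pr_S[∃ h ∈ H, h consistent with c on S ∧ R(h) > ε] ≤ |H| (1 - ε)^m`, where
  `R(h) = D{x | h x ≠ c x}` (`genError`);
* `occam_finite_consistent` — Thm. 2.5 itself (sample-complexity form (2.8)): if
  `m ≥ (1/ε) (ln |H| + ln (1/δ))` then that probability is `≤ δ`; i.e. ANY rule returning a
  hypothesis of `H` consistent with the sample has error `≤ ε` with probability `≥ 1 - δ`.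

Both are stated for arbitrary types `X`, `Y` (Mohri's generality); `genError` agrees
definitionally with `Literature.Computability.Learning.errorProb` on `X = (Fin n → Bool)`, `Y = Bool`
(`genError_eq_errorProb`), which is how the Learning route consumes them together with
`IsPACLearnerFor` (a polynomial-time consistent-hypothesis finder for `sizeClass B (n ↦ n^k)`,
`log |H_n| ≤ poly(n)`, is a PAC learner).

## References

* M. Mohri, A. Rostamizadeh, A. Talwalkar, *Foundations of Machine Learning*, 2nd ed., MIT Press
  2018, §2.2, Thm. 2.5 [MohriRostamizadehTalwalkar2018].
* A. Blumer, A. Ehrenfeucht, D. Haussler, M. K. Warmuth, *Occam's razor*, Inform. Process.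
  Lett. 24 (1987) 377–380 [BlumerEhrenfeuchtHausslerWarmuth1987].
* A. Blumer, A. Ehrenfeucht, D. Haussler, M. K. Warmuth, *Learnability and the
  Vapnik–Chervonenkis dimension*, J. ACM 36 (1989), Thm. 2.1 (VC version)
  [BlumerEhrenfeuchtHausslerWarmuth1989].
* M. J. Kearns, U. V. Vazirani, *An Introduction to Computational Learning Theory* (1994),
  Thm. 2.1 [KearnsVazirani1994].
-/

noncomputable section

namespace Literature.Computability.Learning

/-- The generalisation error `R(h) = D{x | h x ≠ c x}` of `h` against the target `c` under `D`
(arbitrary instance and label types). [Mohri–Rostamizadeh–Talwalkar 2018, Def. 2.1]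
[folklore] -/
def genError {X Y : Type*} (D : PMF X) (h c : X → Y) : ENNReal :=
  D.toOuterMeasure {x | h x ≠ c x}

/-- On Boolean functions `genError` is `errorProb`. [folklore] -/
@[simp] theorem genError_eq_errorProb {n : ℕ} (D : PMF (Fin n → Bool))
    (h f : (Fin n → Bool) → Bool) : genError D h f = errorProb D h f := rfl

/-- `h` is consistent with `c` on the sample `S`: empirical error `0`.
[Mohri–Rostamizadeh–Talwalkar 2018, §2.2] [folklore] -/
def IsConsistentOn {X Y : Type*} (h c : X → Y) (S : List X) : Prop := ∀ x ∈ S, h x = c x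

/-- The bad event of Occam's bound: some hypothesis of `H` is consistent with `c` on `S` yet has
generalisation error `> ε`. [Mohri–Rostamizadeh–Talwalkar 2018, proof of Thm. 2.5] [folklore] -/
def occamBadEvent {X Y : Type*} (D : PMF X) (c : X → Y) (H : Finset (X → Y)) (ε : ℝ) :
    Set (List X) :=
  {S | ∃ h ∈ H, IsConsistentOn h c S ∧ ENNReal.ofReal ε < genError D h c}

/-- **Occam's razor, uniform bound** (proof of Mohri–Rostamizadeh–Talwalkar Thm. 2.5: for
`R(h) > ε`, `Pr[h consistent on S] ≤ (1-ε)^m`, then the union bound over `H`): for `ε > 0` and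
`m` i.i.d. samples, `Pr_{S ∼ D^m}[∃ h ∈ H consistent on S with R(h) > ε] ≤ |H| (1 - ε)^m`.
[cite: MohriRostamizadehTalwalkar2018, Thm. 2.5 (proof)] -/
def occam_uniform_bound : Prop :=
  ∀ {X Y : Type} (D : PMF X) (c : X → Y) (H : Finset (X → Y)) (ε : ℝ), 0 < ε → ε ≤ 1 →
    ∀ m : ℕ, (iidList D m).toOuterMeasure (occamBadEvent D c H ε) ≤
      (H.card : ENNReal) * ENNReal.ofReal ((1 - ε) ^ m)

/-- **Occam's razor / learning bound, finite `H`, consistent case** (Mohri–Rostamizadeh–Talwalkar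
2018, Thm. 2.5, sample-complexity form (2.8); BEHW 1987; Kearns–Vazirani Thm. 2.1): for
`ε, δ > 0` and `m ≥ (1/ε)(ln |H| + ln (1/δ))` i.i.d. samples, with probability `≥ 1 - δ` every
hypothesis of `H` consistent with the target on the sample has error `≤ ε`; equivalently the bad
event has probability `≤ δ`. Hence any algorithm returning a consistent hypothesis of `H` is a
PAC learner with this sample size. [cite: MohriRostamizadehTalwalkar2018, Thm. 2.5] -/
def occam_finite_consistent : Prop :=
  ∀ {X Y : Type} (D : PMF X) (c : X → Y) (H : Finset (X → Y)) (ε δ : ℝ), 0 < ε → ε ≤ 1 →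
    0 < δ → ∀ m : ℕ, (1 / ε) * (Real.log H.card + Real.log (1 / δ)) ≤ m →
      (iidList D m).toOuterMeasure (occamBadEvent D c H ε) ≤ ENNReal.ofReal δ

/-- The sample-complexity form follows from the uniform bound and `|H| (1-ε)^m ≤ |H| e^{-εm} ≤ δ`.
[Mohri–Rostamizadeh–Talwalkar 2018, proof of Thm. 2.5, last step] [folklore] -/
theorem occam_finite_consistent_of_uniform (h : occam_uniform_bound) : occam_finite_consistent := by
  intro X Y D c H ε δ hε hε1 hδ m hm
  refine (h D c H ε hε hε1 m).trans ?_
  -- |H| (1-ε)^m ≤ |H| exp(-ε m) ≤ δ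
  rcases Nat.eq_zero_or_pos H.card with hH | hH
  · simp [hH]
  have hHpos : (0 : ℝ) < H.card := by exact_mod_cast hH
  have h1 : (1 - ε) ^ m ≤ Real.exp (-(ε * m)) := by
    calc (1 - ε) ^ m ≤ (Real.exp (-ε)) ^ m := by
          apply pow_le_pow_left₀ (by linarith)
          have := Real.add_one_le_exp (-ε)
          linarith
      _ = Real.exp (-(ε * m)) := by rw [← Real.exp_nat_mul]; ring_nf
  have h2 : (H.card : ℝ) * Real.exp (-(ε * m)) ≤ δ := by
    have hm' : Real.log H.card + Real.log (1 / δ) ≤ ε * m := by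
      have := mul_le_mul_of_nonneg_left hm hε.le
      rwa [← mul_assoc, mul_one_div_cancel hε.ne', one_mul] at this
    have : Real.log ((H.card : ℝ) * (1 / δ)) ≤ ε * m := by
      rwa [Real.log_mul hHpos.ne' (by positivity)]
    have h3 : (H.card : ℝ) * (1 / δ) ≤ Real.exp (ε * m) := by
      rw [← Real.log_le_iff_le_exp (by positivity)]
      exact this
    rw [Real.exp_neg]
    have h4 : (H.card : ℝ) * (1 / δ) * δ ≤ Real.exp (ε * m) * δ :=
      mul_le_mul_of_nonneg_right h3 hδ.le
    rw [mul_assoc, one_div_mul_cancel hδ.ne', mul_one] at h4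
    calc (H.card : ℝ) * (Real.exp (ε * m))⁻¹ = (H.card : ℝ) / Real.exp (ε * m) := by
          rw [div_eq_mul_inv]
      _ ≤ δ := by rw [div_le_iff₀ (Real.exp_pos _), mul_comm]; exact h4
  calc (H.card : ENNReal) * ENNReal.ofReal ((1 - ε) ^ m)
      = ENNReal.ofReal ((H.card : ℝ) * (1 - ε) ^ m) := by
        rw [ENNReal.ofReal_mul hHpos.le, ENNReal.ofReal_natCast]
    _ ≤ ENNReal.ofReal δ := ENNReal.ofReal_le_ofReal
        ((mul_le_mul_of_nonneg_left h1 hHpos.le).trans h2)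

end Literature.Computability.Learning

end
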